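import Summits.BirchSwinnertonDyer.Rank1Residual.GaloisImage.ThreeDivisionPolynomialList
import Summits.BirchSwinnertonDyer.Rank1Residual.GaloisImage.LocalThreeTorsionDeciderAt
import HarnessLib

/-!
# Certificates for local `n`-divisibility of a rational point: ONE Hensel ball, integrality of
# roots, and the computable checkers (team n1011, row T-DIV3L, FILE D2 — lead R5-82 (k) / R5-83 (d)
# "road (b)"; the soundness theorems are FILE D3 `LocalThreeDivisibilityDeciderAt`)

HONEST FRAMING (cell `b2b-bsdres`, run/shared/lean/b2b/bsd-rank1-residual/, verbatim in every
file): the goal of the cell is to DELETE the COMBINATION-SHAPED residual classes of the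
Birch–Swinnerton-Dyer formula for ALL analytic-rank `≤ 1` elliptic curves over `ℚ` — "full BSD
formula for every rank `≤ 1` curve in class `C`" assembled STRICTLY from published theorems — so
that the rank-`≤ 1` remainder becomes exactly the CONSTRUCTION-SHAPED classes, which are TYPED
(missing-input `Prop`s), NOT attempted. This is not "finishing BSD". Team n1011 (N10/N11): research
route; this file is a TOOL (pure `p`-adic algebra on integer polynomials + bookkeeping); nothing is
booked by it; no mark / label moved; X4 stays CONSTRUCTION-SHAPED. THEOREMS + small COMPUTABLE
certificate-checker definitions (`Bool`-valued, no mathematical content); no named fact, no `sorry`.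

## What

* §1 Two `p`-adic lemmas on an integer polynomial `F = ofList l` (T-LOC3T FILE A currency):
  `exists_root_of_hensel_data` — `p^m ∥ F′(c)`, `p^N ∣ F(c)`, `2m + 1 ≤ N` ⟹ a root `z ∈ ℤ_p` with
  `‖z − c‖ ≤ p^{-(N−m)}` (Mathlib `hensels_lemma`); `norm_le_one_of_aeval_eq_zero` — if the leading
  (= last) coefficient is a `p`-unit, every root in `ℚ_p` lies in `ℤ_p` (ultrametric equality case,
  `norm_aeval_ofList_eq_of_one_lt_norm`).
* §2 The checkers of the local-divisibility decider (FILE D3): `henselOKAt` (one ball),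
  `divCertOKAt p l lg (c, m, N, w)` (one ball of the division equation `l` + the `g`-square datum of
  T-LOC3L FILE L3 `gEntryOKAt` / `sqFlagAt`), `lastUnitAt`, `nonDivCheckAt p l k` (unit leading
  coefficient + EMPTY root census `RootCensus.check₂ p l k []`), and their `n = 3` specialisations
  `threeDivCertAt` / `threeNonDivCheckAt` on FILE D1's `threeDivList`; `_spec` unpacking lemmas.

References: Hensel's lemma (Mathlib); [Cassels1986] Ch. 4 §3 (provenance only).
-/

set_option autoImplicit false

noncomputable section

open scoped Classical
open Polynomial WeierstrassCurve
open Summit.BirchSwinnertonDyer.Rank1Residual.GaloisImage.RootCensus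
open Summit.BirchSwinnertonDyer.Rank1Residual.GaloisImage.PadicSquareClass
open Summit.BirchSwinnertonDyer.Rank1Residual.GaloisImage.LocalTorsion3 (bInvs gList equation_iff_sq_eq_g)
open Summit.BirchSwinnertonDyer.Rank1Residual.GaloisImage.LocalTorsion3At
  (sqPrecAt sqFlagAt gEntryOKAt one_le_sqPrecAt sqPrecAt_eq_three_of_eq_two
    isSquare_intCast_padic_iff_sqFlagAt)
open Summit.BirchSwinnertonDyer.Rank1Residual.GaloisImage.ThreeDivision

namespace Summit.BirchSwinnertonDyer.Rank1Residual.GaloisImage.DivisionDecider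

/-! ### §1 Two `p`-adic lemmas on integer polynomials: one Hensel ball; integrality of roots -/

section Padic

variable {p : ℕ} [hp : Fact p.Prime]

/-- `1 < p` as real numbers. -/
private theorem one_lt_p : (1 : ℝ) < p := by exact_mod_cast hp.out.one_lt

/-- **One Hensel ball.** If `p^m ∥ F′(c)`, `p^N ∣ F(c)` and `2m + 1 ≤ N` for the integer
polynomial `F = ofList l` and an integer `c`, then `F` has a root `z ∈ ℤ_p` with
`‖z − c‖ ≤ p^{-(N−m)}` (Mathlib `hensels_lemma`; the a-posteriori precision is
`‖F(c)‖ / ‖F′(c)‖`). [folklore] -/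
theorem exists_root_of_hensel_data (l : List ℤ) {c : ℤ} {m N : ℕ} (hN : 2 * m + 1 ≤ N)
    (hdm : (p : ℤ) ^ m ∣ evalDerivList l c) (hndm : ¬ (p : ℤ) ^ (m + 1) ∣ evalDerivList l c)
    (hdN : (p : ℤ) ^ N ∣ evalList l c) :
    ∃ z : ℤ_[p], aeval z (ofList l) = 0 ∧ ‖z - (c : ℤ_[p])‖ ≤ (p : ℝ) ^ (-((N - m : ℕ) : ℤ)) := by
  have hp1 := one_lt_p (p := p)
  set F := ofList l with hF
  have h1 : ‖aeval (c : ℤ_[p]) F.derivative‖ = (p : ℝ) ^ (-(m : ℤ)) := by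
    rw [hF, aeval_intCast_derivative_ofList]; exact norm_intCast_eq_of_dvd_of_not_dvd hdm hndm
  have h2 : ‖aeval (c : ℤ_[p]) F‖ ≤ (p : ℝ) ^ (-(N : ℤ)) := by
    rw [hF, aeval_intCast_ofList]; exact norm_intCast_le_of_dvd hdN
  have hlt : ‖aeval (c : ℤ_[p]) F‖ < ‖aeval (c : ℤ_[p]) F.derivative‖ ^ 2 := by
    rw [h1, ← zpow_natCast, ← zpow_mul]
    refine h2.trans_lt (zpow_lt_zpow_right₀ hp1 ?_)
    push_cast; omega
  obtain ⟨z, hz0, hzlt, -, -⟩ := hensels_lemma hlt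
  refine ⟨z, hz0, ?_⟩
  have hprec := norm_aeval_eq_mul_of_root F hz0 hzlt
  rw [h1] at hprec
  have hpow : (0 : ℝ) < (p : ℝ) ^ (-(m : ℤ)) := zpow_pos (by positivity) _
  have : ‖z - (c : ℤ_[p])‖ = ‖aeval (c : ℤ_[p]) F‖ / (p : ℝ) ^ (-(m : ℤ)) := by
    rw [hprec, mul_div_cancel_left₀ _ hpow.ne']
  rw [this, div_le_iff₀ hpow, ← zpow_add₀ (by positivity)]
  refine h2.trans (zpow_le_zpow_right₀ hp1.le ?_)
  omega

/-- If the last coefficient of `l` is a `p`-unit then, at any `z ∈ ℚ_p` with `‖z‖ > 1`, the leading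
term dominates: `‖F(z)‖ = ‖z‖^{deg}` (ultrametric inequality, equality case). [folklore] -/
theorem norm_aeval_ofList_eq_of_one_lt_norm :
    ∀ (l : List ℤ) (c : ℤ), l.getLast? = some c → ¬ (p : ℤ) ∣ c → ∀ {z : ℚ_[p]}, 1 < ‖z‖ →
      ‖aeval z (ofList l)‖ = ‖z‖ ^ (l.length - 1)
  | [], c, h, _, _, _ => by simp at h
  | [a], c, h, hc, z, hz => by
    simp only [List.getLast?_singleton, Option.some.injEq] at h
    subst h
    simp only [aeval_ofList_cons, aeval_ofList_nil, mul_zero, add_zero, List.length_singleton,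
      Nat.sub_self, pow_zero]
    have hle : ‖(a : ℚ_[p])‖ ≤ 1 := Padic.norm_int_le_one a
    have hlt : ¬ ‖(a : ℚ_[p])‖ < 1 := fun h => hc (Padic.norm_intCast_lt_one_iff.mp h)
    exact le_antisymm hle (not_lt.mp hlt)
  | a :: b :: l, c, h, hc, z, hz => by
    have htail : (b :: l).getLast? = some c := by
      rw [List.getLast?_cons_cons] at h; exact h
    have ih := norm_aeval_ofList_eq_of_one_lt_norm (b :: l) c htail hc hz
    rw [aeval_ofList_cons]
    have hmul : ‖z * aeval z (ofList (b :: l))‖ = ‖z‖ ^ ((a :: b :: l).length - 1) := by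
      rw [norm_mul, ih]
      simp only [List.length_cons, Nat.add_sub_cancel]
      ring
    have hbig : 1 < ‖z * aeval z (ofList (b :: l))‖ := by
      rw [hmul]
      exact one_lt_pow₀ hz (by simp)
    have hne : ‖(a : ℚ_[p])‖ ≠ ‖z * aeval z (ofList (b :: l))‖ :=
      ((Padic.norm_int_le_one a).trans_lt hbig).ne
    rw [Padic.add_eq_max_of_ne hne, max_eq_right ((Padic.norm_int_le_one a).trans hbig.le),
      hmul]

/-- **Integrality of roots.** If the last (= leading) coefficient of the integer polynomial
`F = ofList l` is a `p`-unit, every root of `F` in `ℚ_p` lies in `ℤ_p`. [folklore] -/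
theorem norm_le_one_of_aeval_eq_zero (l : List ℤ) {c : ℤ} (hl : l.getLast? = some c)
    (hc : ¬ (p : ℤ) ∣ c) {z : ℚ_[p]} (hz : aeval z (ofList l) = 0) : ‖z‖ ≤ 1 := by
  by_contra h
  have h1 : 1 < ‖z‖ := not_le.mp h
  have := norm_aeval_ofList_eq_of_one_lt_norm l c hl hc h1
  rw [hz, norm_zero] at this
  exact (pow_pos (zero_lt_one.trans h1) _).ne this

end Padic

/-! ### §2 The certificate checkers (computable; no mathematical content) -/

/-- Hensel data of ONE ball `(c, m, N)` for the integer polynomial with coefficient list `l`: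
`2m + 1 ≤ N`, `p^m ∣ F′(c)`, `p^{m+1} ∤ F′(c)`, `p^N ∣ F(c)` (integer arithmetic). [folklore] -/
def henselOKAt (p : ℕ) (l : List ℤ) (c : ℤ) (m N : ℕ) : Bool :=
  decide (2 * m + 1 ≤ N) && (evalDerivList l c % (p : ℤ) ^ m == 0) &&
    !(evalDerivList l c % (p : ℤ) ^ (m + 1) == 0) && (evalList l c % (p : ℤ) ^ N == 0)

/-- **YES-certificate check** for the division equation `l` and the `g`-list `lg` at the entry
`(c, m, N, w)`: Hensel data for `l` at `c`, and the `g`-square datum `p^w ∥ g(c)`,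
`w + δ_p + m ≤ N`, square flag (T-LOC3L FILE L3 `gEntryOKAt`, `sqFlagAt`). [folklore] -/
def divCertOKAt (p : ℕ) (l lg : List ℤ) (e : ℤ × ℕ × ℕ × ℕ) : Bool :=
  henselOKAt p l e.1 e.2.1 e.2.2.1 && gEntryOKAt p lg e && sqFlagAt p (evalList lg e.1) e.2.2.2

/-- The last (= leading) coefficient of `l` is a `p`-unit. [folklore] -/
def lastUnitAt (p : ℕ) (l : List ℤ) : Bool :=
  match l.getLast? with
  | none => false
  | some c => !(c % (p : ℤ) == 0)

/-- **NO-certificate check**: unit leading coefficient and EMPTY root census of `l` in `ℤ_p` at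
precision `k` (T-LOC3T FILE A1b `RootCensus.check₂` with the empty certificate). READING RULE for
records seats: `false` means "no verdict at this `(p, k)`", NOT "not divisible" — in particular at
`p ∣` leading coefficient (for `threeDivList`: `p ∣ den x`, i.e. `P ∈ E₁(ℚ_p)`) this check is silent
by design (`lastUnitAt = false`), while the YES check `divCertOKAt` still applies there. [folklore] -/
def nonDivCheckAt (p : ℕ) (l : List ℤ) (k : ℕ) : Bool :=
  lastUnitAt p l && check₂ p l k []

/-- **YES check for `3`-division** of the point with `x = num / den` on the integer model
`⟨a₁, …, a₆⟩` at `p`, entry `(c, m, N, w)`. [folklore] -/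
def threeDivCertAt (p : ℕ) (a₁ a₂ a₃ a₄ a₆ : ℤ) (num : ℤ) (den : ℕ) (e : ℤ × ℕ × ℕ × ℕ) : Bool :=
  divCertOKAt p (threeDivList a₁ a₂ a₃ a₄ a₆ num den) (gList a₁ a₂ a₃ a₄ a₆) e

/-- **NO check for `3`-division** of the point with `x = num / den` on `⟨a₁, …, a₆⟩` at `p`,
precision `k`. [folklore] -/
def threeNonDivCheckAt (p : ℕ) (a₁ a₂ a₃ a₄ a₆ : ℤ) (num : ℤ) (den : ℕ) (k : ℕ) : Bool :=
  nonDivCheckAt p (threeDivList a₁ a₂ a₃ a₄ a₆ num den) k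

section Unpack

variable {p : ℕ} {l lg : List ℤ}

/-- What `henselOKAt` certifies. [folklore] -/
theorem henselOKAt_spec {c : ℤ} {m N : ℕ} (h : henselOKAt p l c m N = true) :
    2 * m + 1 ≤ N ∧ (p : ℤ) ^ m ∣ evalDerivList l c ∧ ¬ (p : ℤ) ^ (m + 1) ∣ evalDerivList l c ∧
      (p : ℤ) ^ N ∣ evalList l c := by
  simp only [henselOKAt, Bool.and_eq_true, decide_eq_true_eq, beq_iff_eq, Bool.not_eq_true',
    beq_eq_false_iff_ne, ne_eq, emod_eq_zero_iff_dvd'] at h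
  exact ⟨h.1.1.1, h.1.1.2, h.1.2, h.2⟩

/-- What `gEntryOKAt` certifies. [folklore] -/
theorem gEntryOKAt_spec {e : ℤ × ℕ × ℕ × ℕ} (h : gEntryOKAt p lg e = true) :
    (p : ℤ) ^ e.2.2.2 ∣ evalList lg e.1 ∧ ¬ (p : ℤ) ^ (e.2.2.2 + 1) ∣ evalList lg e.1 ∧
      e.2.2.2 + sqPrecAt p + e.2.1 ≤ e.2.2.1 := by
  simp only [gEntryOKAt, Bool.and_eq_true, beq_iff_eq, Bool.not_eq_true', beq_eq_false_iff_ne,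
    ne_eq, emod_eq_zero_iff_dvd', decide_eq_true_eq] at h
  exact ⟨h.1.1, h.1.2, h.2⟩

/-- What `lastUnitAt` certifies. [folklore] -/
theorem exists_of_lastUnitAt (h : lastUnitAt p l = true) :
    ∃ c : ℤ, l.getLast? = some c ∧ ¬ (p : ℤ) ∣ c := by
  unfold lastUnitAt at h
  split at h
  · exact absurd h Bool.false_ne_true
  · next c hc =>
    refine ⟨c, hc, ?_⟩
    simpa [emod_eq_zero_iff_dvd'] using h

end Unpack

end Summit.BirchSwinnertonDyer.Rank1Residual.GaloisImage.DivisionDecider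

end
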